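import Summits.BirchSwinnertonDyer.BirchSwinnertonDyer.Theorems.WildThreeRankOneBSDpOfKolyvaginCertificateKatoTwist
import Summits.BirchSwinnertonDyer.BirchSwinnertonDyer.Theorems.AdditiveRankOneRowKernelsOddTwist
import Summits.BirchSwinnertonDyer.BirchSwinnertonDyer.Theorems.KatoDescentTamePotSupersingularTameUpperHeegnerTwist
import Summits.BirchSwinnertonDyer.BirchSwinnertonDyer.Theses.TameQuarticSolvent
import Summits.BirchSwinnertonDyer.BirchSwinnertonDyer.Theses.TameQuarticManinParity
import Summits.BirchSwinnertonDyer.BirchSwinnertonDyer.Theorems.SemiOrdinaryEisensteinDescentWildSplitEisensteinInclusionAtThreeIndivisibilityRoad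
import HarnessLib

/-!
# Routes `TameQuarticSolvent` (crux `SolventPairLowerBound`, stmt-BirchSwinnertonDyer-21391) and
# `TameQuarticManinParity` (crux #5 `TprimeRankOneLowerAtThree`, stmt-BirchSwinnertonDyer-23739):
# THE KOLYVAGIN-CERTIFICATE / REFINED-KOLYVAGIN ROAD to the (t′) rank-one LOWER half at `3`

Width seat `bsd-wall-tqs-p1-w2` g5 (cell `pub/bsd-wall`), 2026-08-28; `--supports stmt-BirchSwinnertonDyer-21391`, helper.
HONEST FRAMING: theorems only, CONDITIONAL on every displayed hypothesis; no definition, no named fact, no `sorry`; credits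
nothing toward closing 21391 / 23739; BSD is not proved for any curve by this file.

## Why this file

The (t′) rank-one leaf at `3` (`WAllExclAddTprimeAtThreeRankOne`: `E/ℚ` non-CM, additive at `3` of the tame quartic
class (t′) — `f₃ = 2`, `e = 4`, Kodaira III/III*, potentially supersingular —, `r_an = 1`) has ONE research residual on
its lower side: `TprimeRankOneLowerAtThree` (23739) = `ord₃ Ш_an(E) ≤ ord₃ #Ш(E)`, to which the TQS deciding crux
`SolventPairLowerBound` (21391) is equivalent modulo the rank-zero halves (p588900, p592225). Both routes carry it WITHOUT a
mechanism (TQMP: "not attacked by this line's lever"; TQS: line `birth` moves it to a harder base, LEAD-g4), and every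
signed / `±` / Wach-module Iwasawa theory in print is excluded on the whole leaf (`4 ∣ e(w∣3) > p − 1`).

There is exactly ONE lower-half engine in print with NO hypothesis on the reduction type at `p`: the LOWER half of
Kolyvagin's structure theorem for `Ш(E/K)` — Kolyvagin 1991 / McCallum 1991 Thm. 5.4 / Matar–Nekovář 2019 Thm. 0.7 read
through §0.11 (irreducible `ρ̄_{E,p}`, `p ≠ 2`, `d_K ∉ {−3,−4}`, `p² ∣ N` ALLOWED; tree fact
`MatarNekovar2019.thm07_pow_dvd_card_sha_primary_of_certificate_of_irreducible`): ONE derived Heegner point `P_n` with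
`P_n ∉ 3^{M+1}E(K[n])` forces `3^{2(M₀−M)} ∣ #Ш(E/K)[3^∞]`. Seat utd-p3 g4 turned it into the LOWER index socket
(`SchneiderFree.Exact.lower_of_kolyvaginCertificate_of_irr`, generic odd `p`), seat kmc g20 proved the row kernel
`missingLowerBoundAt_of_indexLower_of_twistUpperOdd_row` (socket at every admissible Heegner datum + the UPPER half of
the rank-zero Heegner twist ⟹ `Typed.MissingLowerBoundAt W p`), and route SOED's width seat w3 g5 composed the analogous
road for the WILD rank-one leaf (p592658, `MinftyGe` currency). Nobody did it for (t′). This file does, in both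
currencies, and keys the result to 23739 / 21391 BY NAME:

* §1 (generic odd additive `p`, row-local) `missingLowerBoundAt_of_kolyvaginCertificates_of_twistUpper_row`:
  `W` non-CM, `Addv W p`, `ρ̄_{E,p}` irreducible, `r_an = 1`: ToricPublishedInputs ∧ MN19 Thm 0.7 (lower) ∧ [at every
  admissible Heegner datum of `W` (`d_K` odd `< −4`, Heegner for `N_E`, `L(E^{(d_K)},1) ≠ 0`, `P = y_K`) ONE Kolyvagin
  NON-divisibility certificate at depth `ord_p ∏_ℓ c_ℓ(E) + v_p(c(Dt)) + 1`] ∧ [the UPPER half of every globally minimal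
  model of such a twist] ⟹ `Typed.MissingLowerBoundAt W p`; and the ONE-DATUM door `…_at_datum` (instrument-facing).
* §2 (`p = 3`, the (t′) rows) `tprime_missingLowerBoundAt_three_of_kolyvaginCertificates`: the twist's upper half is
  DISCHARGED BY NAME by TQS crux #4 `TprimeRankZeroUpperAtThree` (stmt-21393 = route KT's `p = 3` upper items): the
  Heegner twist of a non-CM (t′) row is a non-CM (t′) row of analytic rank `0` (`subTprime_twist_of_heegner`).
* §3 `tprimeRankOneLowerAtThree_of_kolyvaginCertificates_of_reducibleRows` — TQMP 23739 BY NAME ⟸ ToricPublishedInputs ∧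
  MN19 ∧ 21393 ∧ CERT(t′) (the certificates on the IRREDUCIBLE (t′) rank-one rows) ∧ the lower half on the REDUCIBLE
  rows (displayed residual). TQS 21391 then follows BY NAME by lead g4's
  `SolventPairLowerBound.solventPairLowerBound_of_tprimeRankOneLowerAtThree_of_tameLowerHalfRankZero` (p588900:
  + modularity, FH at `3`, KT `TameLowerHalfRankZero` 19981 at `p = 3`) — not re-derived here.
* §4 (RKC currency) `tprime_missingLowerBoundAt_three_of_oneClassLowerBound_of_not_minftyGe`: on the `3`-adic
  TOWER-onto rows the same ⟸ `AdditiveThree.OneClassLowerBoundShape` (McCallum 5.4 lower form, O5/O6 cell) ∧ the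
  MANIN-ROBUST INDIVISIBILITY `¬ MinftyGe W K Dt H.β ι (ord₃∏c_ℓ + v₃(c) + 1)` (T1⁻ of the refined Kolyvagin conjecture
  at an additive `3`; `AdditiveThree.RKC3Indivisibility` is its `3 ∤ c` case) — the SAME typed conjecture currency as
  route SOED's wild road p592658: the two rank-one LOWER halves at an additive `3` are ONE conjecture item modulo print.

READING (census N < 5·10⁵, INTRINSIC-CORE-g6): the 7 intrinsic (t′) rank-one classes (`#Ш_an = 9`, `ρ̄₃` onto) are
exactly where a certificate is needed; the one-datum doors turn ONE derived-Heegner-point computation per class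
(Jetchev–Lauter–Stein 2009 §4) into `Typed.MissingLowerBoundAt E 3` — an instrument road, never the ∀-item, which is
research-open (W. Zhang 2014 / BCGS need `p ≥ 5` good ordinary and BD-admissible primes; none at `p = 3`).

References: [MatarNekovar2019] Thm. 0.7, §0.11; [McCallumLMS1991] Thm. 5.4, Cor. 5.6, Lemma 5.1; [Kolyvagin1991StructureSha]
Thm. C/D; [WZhang2014] Thm. 1.1, §3.8; [JetchevLauterStein2009] §4; [JetchevSkinnerWan2017] §7.4.1; [GrossZagier1986] I.(6.3),
Thm. I.(7.3); [FriedbergHoffstein1995] Thm. B; [Kato2004Asterisque] Thm. 14.5 (3); [Miller2011LMS] Def. 1.1.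
-/

noncomputable section

open scoped Classical

set_option linter.dupNamespace false
set_option autoImplicit false

namespace Summit.BirchSwinnertonDyer.BirchSwinnertonDyer.Theorems.TprimeRankOneLowerKolyvagin

open WeierstrassCurve NumberField IsDedekindDomain Field
  Literature.NumberTheory.EllipticCurves
  Literature.NumberTheory.EllipticCurves.ModularForms
  Literature.NumberTheory.EllipticCurves.Rank1Residual
  Literature.NumberTheory.EllipticCurves.Rank1Residual.Typed
  Summit.BirchSwinnertonDyer.Rank1Residual
  Summit.BirchSwinnertonDyer.Rank1Residual.Additive
  Summit.BirchSwinnertonDyer.Rank1Residual.X11b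
  Summit.BirchSwinnertonDyer.Rank1Residual.X11b.Three
  Summit.BirchSwinnertonDyer.BirchSwinnertonDyer.Theses.UniversalToricDescent
  Summit.BirchSwinnertonDyer.BirchSwinnertonDyer.Theorems.UniversalToricDescentWaldspurgerFlat

/-! ### §1 Generic odd additive `p`: Kolyvagin certificates at the admissible Heegner data + the twist's upper half
⟹ the rank-one LOWER half over `ℚ` -/

/-- **The rank-one LOWER half at an odd additive prime from KOLYVAGIN CERTIFICATES — row-local, any reduction type
at `p`.** For ONE globally minimal non-CM `W`, additive at the odd prime `p`, with `ρ̄_{E,p}` irreducible and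
`r_an = 1`: IF at every admissible Heegner datum of `W` (level `N = N_E`, `K` imaginary quadratic Heegner for `N`,
`d_K` odd, `d_K < −4`, `L(E^{(d_K)},1) ≠ 0`, `P ∈ E(K)` mapping to the Heegner point of `(Dt, H)`, of infinite order)
there is ONE Kolyvagin NON-divisibility certificate at depth `ord_p ∏_ℓ c_ℓ(E) + v_p(c(Dt)) + 1` (a square-free `n`,
every `ℓ ∣ n` a Kolyvagin prime of index `≥` that depth, a Kolyvagin–Heegner datum `d` on the frame `(Dt, H.β, ι)`
with `P_n = d.derivedPoint ∉ p^{depth} E(K[n])`), AND every globally minimal model of every such twist satisfies the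
UPPER half `Typed.MissingUpperBoundAt · p`, THEN `Typed.MissingLowerBoundAt W p`. Proof = utd-p3's
`lower_of_kolyvaginCertificate_of_irr` (Matar–Nekovář Thm. 0.7 LOWER half ⟹ STEP L at slack `v_p(c)`) fed into kmc's
row kernel `missingLowerBoundAt_of_indexLower_of_twistUpperOdd_row` (Friedberg–Hoffstein field, Gross–Zagier,
GZ I.(7.3), joint lower bound, upper half of the partner). CONDITIONAL on `hF`, `hMNlow`; closes nothing.
[cite: MatarNekovar2019, Thm. 0.7 (p. 456) and §0.11 (p. 457)] [cite: McCallumLMS1991, §5 Cor. 5.6 and Lemma 5.1]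
[cite: JetchevSkinnerWan2017, §7.4.1 (arXiv:1512.06894 p. 30)] [cite: GrossZagier1986, I.(6.3) and Thm. I.(7.3)] -/
theorem missingLowerBoundAt_of_kolyvaginCertificates_of_twistUpper_row (p : ℕ) [Fact p.Prime] (hp2 : p ≠ 2)
    (hF : ToricPublishedInputs)
    (hMNlow : MatarNekovar2019.thm07_pow_dvd_card_sha_primary_of_certificate_of_irreducible)
    (W : WeierstrassCurve ℚ) [W.IsElliptic] [W.IsGloballyMinimal] (hCM : ¬ W.HasCM) (haddv : Addv W p)
    (hirr : W.HasIrreducibleModPGaloisRep p) (hr : W.analyticRank = 1)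
    (hcert : ∀ (N : ℕ) [NeZero N] (K : Type) [Field K] [NumberField K] (Dt : ModularParametrizationData W N)
      (H : HeegnerDatum N (NumberField.discr K)) (ι : K →+* ℂ) (P : (W.baseChange K).toAffine.Point),
      W.conductorNorm ℤ = N → IsImaginaryQuadratic K → SatisfiesHeegnerHypothesis N K → Odd (NumberField.discr K) →
      NumberField.discr K < -4 → (W.quadraticTwist (NumberField.discr K : ℚ)).entireLFunction 1 ≠ 0 →
      WeierstrassCurve.Affine.Point.map ι.toRatAlgHom P = heegnerPointComplex Dt H → ¬ IsOfFinAddOrder P →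
      ∃ (n : ℕ) (d : KolyvaginHeegnerData Dt H.β ι n), Squarefree n ∧
        (∀ ℓ ∈ n.primeFactors, Zhang2014.IsKolyvaginPrime N W K p ℓ ∧
          padicValNat p W.tamagawaProduct + padicValNat p Dt.c.natAbs + 1 ≤ Zhang2014.kolyvaginIndex W p ℓ) ∧
        ¬ Koly.PDiv d p (padicValNat p W.tamagawaProduct + padicValNat p Dt.c.natAbs + 1))
    (hTwUp : ∀ (N : ℕ) [NeZero N] (K : Type) [Field K] [NumberField K]
      (Wd : WeierstrassCurve ℚ) [Wd.IsElliptic] [Wd.IsGloballyMinimal],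
      W.conductorNorm ℤ = N → IsImaginaryQuadratic K → SatisfiesHeegnerHypothesis N K → Odd (NumberField.discr K) →
      NumberField.discr K < -4 → (∃ C : VariableChange ℚ, C • W.quadraticTwist (NumberField.discr K : ℚ) = Wd) →
      (W.quadraticTwist (NumberField.discr K : ℚ)).entireLFunction 1 ≠ 0 → MissingUpperBoundAt Wd p) :
    MissingLowerBoundAt W p := by
  refine missingLowerBoundAt_of_indexLower_of_twistUpperOdd_row p hp2 hF W haddv hr ?_ hTwUp
  intro N _ K _ _ Dt H ι P hN hK hHN hodd hd4 hLd hP hnt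
  subst hN
  have h3 : NumberField.discr K ≠ -3 := by omega
  have h4 : NumberField.discr K ≠ -4 := by omega
  exact SchneiderFree.Exact.lower_of_kolyvaginCertificate_of_irr hF.2.1 hMNlow W hCM p hp2 hirr K hK h3 h4 hHN Dt H ι P
    hP hnt (hcert _ K Dt H ι P rfl hK hHN hodd hd4 hLd hP hnt)

/-- **The ONE-DATUM door (instrument-facing).** For ONE globally minimal non-CM `W`, additive at the odd prime `p`,
`ρ̄_{E,p}` irreducible, `r_an = 1`, and ONE Heegner datum: `K` imaginary quadratic Heegner for `N_E` with `d_K` odd,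
`d_K < −4` and `L(E^{(d_K)},1) ≠ 0`, a frame `(Dt, H, ι)` at level `N_E` with `P ∈ E(K)` mapping to its Heegner point,
a globally minimal model `Wd` of `E^{(d_K)}`: ONE Kolyvagin NON-divisibility certificate at depth
`ord_p ∏_ℓ c_ℓ(E) + v_p(c(Dt)) + 1` together with the UPPER half `Typed.MissingUpperBoundAt Wd p` of that one twist give
`Typed.MissingLowerBoundAt W p` (`P` is of infinite order by Gross–Zagier; STEP L by Matar–Nekovář's lower half; joint
lower bound over the pair by kmc g17's `jointLowerBoundAt_of_stepL_manin`; then `missingLowerBoundAt_of_joint_of_upper`).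
CONDITIONAL on `hF`, `hMNlow`; CERTIFICATE currency — closes no class. [cite: MatarNekovar2019, Thm. 0.7 (p. 456) and §0.11 (p. 457)]
[cite: GrossZagier1986, I.(6.3) and Thm. I.(7.3)] [cite: JetchevSkinnerWan2017, §7.4.1 (arXiv:1512.06894 p. 30)]
[cite: JetchevLauterStein2009, §4 (the computation of one derived class)] -/
theorem missingLowerBoundAt_of_kolyvaginCertificate_at_datum (p : ℕ) [Fact p.Prime] (hp2 : p ≠ 2)
    (hF : ToricPublishedInputs)
    (hMNlow : MatarNekovar2019.thm07_pow_dvd_card_sha_primary_of_certificate_of_irreducible)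
    (W : WeierstrassCurve ℚ) [W.IsElliptic] [W.IsGloballyMinimal] [NeZero (W.conductorNorm ℤ)]
    (hCM : ¬ W.HasCM) (haddv : Addv W p) (hirr : W.HasIrreducibleModPGaloisRep p) (hr : W.analyticRank = 1)
    (K : Type) [Field K] [NumberField K] (hK : IsImaginaryQuadratic K)
    (hHN : SatisfiesHeegnerHypothesis (W.conductorNorm ℤ) K) (hodd : Odd (NumberField.discr K))
    (hd4 : NumberField.discr K < -4) (hLd : (W.quadraticTwist (NumberField.discr K : ℚ)).entireLFunction 1 ≠ 0)
    (Dt : ModularParametrizationData W (W.conductorNorm ℤ))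
    (H : HeegnerDatum (W.conductorNorm ℤ) (NumberField.discr K)) (ι : K →+* ℂ)
    (P : (W.baseChange K).toAffine.Point)
    (hP : WeierstrassCurve.Affine.Point.map ι.toRatAlgHom P = heegnerPointComplex Dt H)
    (Wd : WeierstrassCurve ℚ) [Wd.IsElliptic] [Wd.IsGloballyMinimal]
    (hWd : ∃ C : VariableChange ℚ, C • W.quadraticTwist (NumberField.discr K : ℚ) = Wd)
    (hcert : ∃ (n : ℕ) (d : KolyvaginHeegnerData Dt H.β ι n), Squarefree n ∧
        (∀ ℓ ∈ n.primeFactors, Zhang2014.IsKolyvaginPrime (W.conductorNorm ℤ) W K p ℓ ∧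
          padicValNat p W.tamagawaProduct + padicValNat p Dt.c.natAbs + 1 ≤ Zhang2014.kolyvaginIndex W p ℓ) ∧
        ¬ Koly.PDiv d p (padicValNat p W.tamagawaProduct + padicValNat p Dt.c.natAbs + 1))
    (hUp : MissingUpperBoundAt Wd p) :
    MissingLowerBoundAt W p := by
  have hp : p.Prime := Fact.out
  obtain ⟨hGZ, hKo, hGZK, hmod, -, -, hGZ73, -, -, -⟩ := hF
  have h3 : NumberField.discr K ≠ -3 := by omega
  have h4 : NumberField.discr K ≠ -4 := by omega
  have hwK : ¬ p ∣ Units.torsionOrder K := by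
    rw [Literature.NumberTheory.QuadraticFields.Quadratic.torsionOrder_eq_two_of_discr_lt_neg_four hK.1 hd4]
    intro h
    exact hp2 ((Nat.prime_dvd_prime_iff_eq hp Nat.prime_two).mp h)
  have hpN : p ∣ W.conductorNorm ℤ :=
    (W.dvd_conductorNorm_iff_not_hasGoodReductionAtPrime p).mpr (not_good_of_addv W p haddv)
  -- the Heegner point is of infinite order (Gross–Zagier: `L′(E/K,1) = L′(E,1)·L(E^{(d_K)},1) ≠ 0`)
  have hL0 : W.entireLFunction 1 = 0 := entireLFunction_one_eq_zero_of_analyticRank_eq_one hr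
  obtain ⟨-, hderiv⟩ := leadingLCoeff_eq_deriv_of_analyticRank_eq_one hr
  have hLK : LDerivEK W K ≠ 0 := by
    rw [KrizLi2019.lDerivEK_eq_deriv_mul W K hmod hL0]; exact mul_ne_zero hderiv hLd
  have hnt : ¬ IsOfFinAddOrder P :=
    (lDerivEK_ne_zero_iff_not_isOfFinAddOrder W (W.conductorNorm ℤ) K (hGZ _ W K) hK hHN ⟨Dt, H, ι, hP⟩).mp hLK
  -- STEP L at slack `v_p(c)` from the certificate (Matar–Nekovář, lower half)
  have hlo : SchneiderFree.IndexLowerBoundLeAt W p K P (padicValNat p Dt.c.natAbs) :=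
    SchneiderFree.Exact.lower_of_kolyvaginCertificate_of_irr hKo hMNlow W hCM p hp2 hirr K hK h3 h4 hHN Dt H ι P
      hP hnt hcert
  -- joint lower bound over the pair `(E, E^{(d_K)})`, then peel off the partner's upper half
  exact missingLowerBoundAt_of_joint_of_upper
    (SchneiderFree.Exact.jointLowerBoundAt_of_stepL_manin hGZ hKo hGZK hmod hGZ73 W p (W.conductorNorm ℤ) K Dt H ι P
      Wd hr rfl hpN hK hodd hwK hHN hLd hP hWd hp2 hlo) hUp

/-! ### §2 The (t′) rows at `p = 3`: the twist's upper half is TQS crux #4 `TprimeRankZeroUpperAtThree` (stmt-21393) -/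

/-- The Heegner twist of a non-CM (t′) row with `L(E^{(d_K)},1) ≠ 0` is a non-CM (t′) row of analytic rank `0`, so
its UPPER half at `3` is an instance of TQS crux #4 `TprimeRankZeroUpperAtThree` (stmt-BirchSwinnertonDyer-21393, = route
KT's `p = 3` upper-half items). Bookkeeping: `subTprime_twist_of_heegner` (k8t-c4), `hasCM_iff_of_model_twist`,
`entireLFunction_smul`. [folklore] [cite: SilvermanATAEC1994, IV.9.4 (PDF pp. 344–346)] -/
theorem missingUpperBoundAt_twist_of_tprimeRankZeroUpperAtThree
    (hU0 : Summit.BirchSwinnertonDyer.BirchSwinnertonDyer.Theses.TameQuarticSolvent.TprimeRankZeroUpperAtThree)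
    (W : WeierstrassCurve ℚ) [W.IsElliptic] [W.IsGloballyMinimal] (hCM : ¬ W.HasCM) (hadd : Addv W 3)
    (hT : SubTprime W 3) {N : ℕ} (hN : W.conductorNorm ℤ = N)
    (K : Type) [Field K] [NumberField K] (hK : IsImaginaryQuadratic K) (hHN : SatisfiesHeegnerHypothesis N K)
    (hodd : Odd (NumberField.discr K)) (Wd : WeierstrassCurve ℚ) [Wd.IsElliptic] [Wd.IsGloballyMinimal]
    (hWd : ∃ C : VariableChange ℚ, C • W.quadraticTwist (NumberField.discr K : ℚ) = Wd)
    (hLd : (W.quadraticTwist (NumberField.discr K : ℚ)).entireLFunction 1 ≠ 0) : MissingUpperBoundAt Wd 3 := by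
  have hD0 : (NumberField.discr K : ℚ) ≠ 0 := by exact_mod_cast NumberField.discr_ne_zero K
  haveI : (W.quadraticTwist (NumberField.discr K : ℚ)).IsElliptic := W.isElliptic_quadraticTwist hD0
  obtain ⟨Cd, hCd⟩ := hWd
  have hLd1 : Wd.entireLFunction 1 ≠ 0 := by rw [← hCd, entireLFunction_smul]; exact hLd
  have hrd : Wd.analyticRank = 0 := analyticRank_eq_zero_of_entireLFunction_one_ne_zero Wd hLd1
  have hcmd : ¬ Wd.HasCM := fun h ↦ hCM ((hasCM_iff_of_model_twist hD0 ⟨Cd, hCd⟩).mp h)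
  have hHN' : SatisfiesHeegnerHypothesis (W.conductorNorm ℤ) K := hN ▸ hHN
  obtain ⟨haddd, hTd, -⟩ :=
    Summit.BirchSwinnertonDyer.BirchSwinnertonDyer.Theorems.subTprime_twist_of_heegner W 3 hadd hT K hK hHN' hodd
      Wd Cd hCd
  exact hU0 Wd hcmd haddd hTd hrd

/-- **The (t′) rank-one LOWER half at `3` from KOLYVAGIN CERTIFICATES, row-local, with the twist side discharged by
TQS crux #4 (stmt-21393) BY NAME.** For ONE globally minimal non-CM `W`, additive of class (t′) at `3`
(`Addv W 3 ∧ SubTprime W 3`), `ρ̄_{E,3}` irreducible, `r_an = 1`: ToricPublishedInputs ∧ Matar–Nekovář Thm. 0.7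
(lower half) ∧ `TprimeRankZeroUpperAtThree` ∧ [ONE Kolyvagin NON-divisibility certificate at depth
`ord₃ ∏_ℓ c_ℓ(E) + v₃(c(Dt)) + 1` at every admissible Heegner datum of `W`] ⟹ `Typed.MissingLowerBoundAt W 3`.
CONDITIONAL; closes nothing. [cite: MatarNekovar2019, Thm. 0.7 (p. 456) and §0.11 (p. 457)] [cite: GrossZagier1986, Thm. I.(7.3)] -/
theorem tprime_missingLowerBoundAt_three_of_kolyvaginCertificates (hF : ToricPublishedInputs)
    (hMNlow : MatarNekovar2019.thm07_pow_dvd_card_sha_primary_of_certificate_of_irreducible)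
    (hU0 : Summit.BirchSwinnertonDyer.BirchSwinnertonDyer.Theses.TameQuarticSolvent.TprimeRankZeroUpperAtThree)
    (W : WeierstrassCurve ℚ) [W.IsElliptic] [W.IsGloballyMinimal] (hCM : ¬ W.HasCM) (hadd : Addv W 3)
    (hT : SubTprime W 3) (hirr : W.HasIrreducibleModPGaloisRep 3) (hr : W.analyticRank = 1)
    (hcert : ∀ (N : ℕ) [NeZero N] (K : Type) [Field K] [NumberField K] (Dt : ModularParametrizationData W N)
      (H : HeegnerDatum N (NumberField.discr K)) (ι : K →+* ℂ) (P : (W.baseChange K).toAffine.Point),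
      W.conductorNorm ℤ = N → IsImaginaryQuadratic K → SatisfiesHeegnerHypothesis N K → Odd (NumberField.discr K) →
      NumberField.discr K < -4 → (W.quadraticTwist (NumberField.discr K : ℚ)).entireLFunction 1 ≠ 0 →
      WeierstrassCurve.Affine.Point.map ι.toRatAlgHom P = heegnerPointComplex Dt H → ¬ IsOfFinAddOrder P →
      ∃ (n : ℕ) (d : KolyvaginHeegnerData Dt H.β ι n), Squarefree n ∧
        (∀ ℓ ∈ n.primeFactors, Zhang2014.IsKolyvaginPrime N W K 3 ℓ ∧
          padicValNat 3 W.tamagawaProduct + padicValNat 3 Dt.c.natAbs + 1 ≤ Zhang2014.kolyvaginIndex W 3 ℓ) ∧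
        ¬ Koly.PDiv d 3 (padicValNat 3 W.tamagawaProduct + padicValNat 3 Dt.c.natAbs + 1)) :
    MissingLowerBoundAt W 3 :=
  haveI : Fact (Nat.Prime 3) := ⟨Nat.prime_three⟩
  missingLowerBoundAt_of_kolyvaginCertificates_of_twistUpper_row 3 (by norm_num) hF hMNlow W hCM hadd hirr hr hcert
    (fun N _ K _ _ Wd _ _ hN hK hHN hodd _ hWd hLd ↦
      missingUpperBoundAt_twist_of_tprimeRankZeroUpperAtThree hU0 W hCM hadd hT hN K hK hHN hodd Wd hWd hLd)

/-- **The (t′) ONE-DATUM door at `3`.** As `missingLowerBoundAt_of_kolyvaginCertificate_at_datum` with the upper half of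
the one twist discharged by TQS crux #4 `TprimeRankZeroUpperAtThree` (stmt-21393): for a non-CM (t′) rank-one `W` with
`ρ̄_{E,3}` irreducible, ONE Heegner field `K` (`d_K` odd `< −4`, Heegner for `N_E`, `L(E^{(d_K)},1) ≠ 0`), ONE frame and ONE
Kolyvagin NON-divisibility certificate at depth `ord₃ ∏_ℓ c_ℓ(E) + v₃(c) + 1` give `Typed.MissingLowerBoundAt W 3`. This is
the kernel consumer of a Jetchev–Lauter–Stein computation on the intrinsic (t′) classes. CERTIFICATE currency; closes no
class. [cite: MatarNekovar2019, Thm. 0.7 (p. 456) and §0.11 (p. 457)] [cite: JetchevLauterStein2009, §4] -/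
theorem tprime_missingLowerBoundAt_three_of_kolyvaginCertificate_at_datum (hF : ToricPublishedInputs)
    (hMNlow : MatarNekovar2019.thm07_pow_dvd_card_sha_primary_of_certificate_of_irreducible)
    (hU0 : Summit.BirchSwinnertonDyer.BirchSwinnertonDyer.Theses.TameQuarticSolvent.TprimeRankZeroUpperAtThree)
    (W : WeierstrassCurve ℚ) [W.IsElliptic] [W.IsGloballyMinimal] [NeZero (W.conductorNorm ℤ)]
    (hCM : ¬ W.HasCM) (hadd : Addv W 3) (hT : SubTprime W 3) (hirr : W.HasIrreducibleModPGaloisRep 3)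
    (hr : W.analyticRank = 1)
    (K : Type) [Field K] [NumberField K] (hK : IsImaginaryQuadratic K)
    (hHN : SatisfiesHeegnerHypothesis (W.conductorNorm ℤ) K) (hodd : Odd (NumberField.discr K))
    (hd4 : NumberField.discr K < -4) (hLd : (W.quadraticTwist (NumberField.discr K : ℚ)).entireLFunction 1 ≠ 0)
    (Dt : ModularParametrizationData W (W.conductorNorm ℤ))
    (H : HeegnerDatum (W.conductorNorm ℤ) (NumberField.discr K)) (ι : K →+* ℂ)
    (P : (W.baseChange K).toAffine.Point)
    (hP : WeierstrassCurve.Affine.Point.map ι.toRatAlgHom P = heegnerPointComplex Dt H)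
    (hcert : ∃ (n : ℕ) (d : KolyvaginHeegnerData Dt H.β ι n), Squarefree n ∧
        (∀ ℓ ∈ n.primeFactors, Zhang2014.IsKolyvaginPrime (W.conductorNorm ℤ) W K 3 ℓ ∧
          padicValNat 3 W.tamagawaProduct + padicValNat 3 Dt.c.natAbs + 1 ≤ Zhang2014.kolyvaginIndex W 3 ℓ) ∧
        ¬ Koly.PDiv d 3 (padicValNat 3 W.tamagawaProduct + padicValNat 3 Dt.c.natAbs + 1)) :
    MissingLowerBoundAt W 3 := by
  haveI : Fact (Nat.Prime 3) := ⟨Nat.prime_three⟩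
  have hD0 : (NumberField.discr K : ℚ) ≠ 0 := by exact_mod_cast NumberField.discr_ne_zero K
  haveI : (W.quadraticTwist (NumberField.discr K : ℚ)).IsElliptic := W.isElliptic_quadraticTwist hD0
  obtain ⟨Cd, hCd⟩ := hasGlobalMinimalModel_rat_holds (W.quadraticTwist (NumberField.discr K : ℚ))
  haveI : (Cd • W.quadraticTwist (NumberField.discr K : ℚ)).IsGloballyMinimal := hCd
  exact missingLowerBoundAt_of_kolyvaginCertificate_at_datum 3 (by norm_num) hF hMNlow W hCM hadd hirr hr K hK hHN hodd
    hd4 hLd Dt H ι P hP (Cd • W.quadraticTwist (NumberField.discr K : ℚ)) ⟨Cd, rfl⟩ hcert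
    (missingUpperBoundAt_twist_of_tprimeRankZeroUpperAtThree hU0 W hCM hadd hT rfl K hK hHN hodd
      (Cd • W.quadraticTwist (NumberField.discr K : ℚ)) ⟨Cd, rfl⟩ hLd)

/-! ### §3 TQMP crux #5 (stmt-23739) BY NAME, modulo the reducible rows (TQS 21391 follows by p588900) -/

/-- **TQMP crux #5 `TprimeRankOneLowerAtThree` (stmt-BirchSwinnertonDyer-23739) BY NAME from Kolyvagin certificates on the
IRREDUCIBLE (t′) rank-one rows and the lower half on the REDUCIBLE ones.** Hypotheses: ToricPublishedInputs; Matar–Nekovář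
Thm. 0.7 (lower half); TQS crux #4 `TprimeRankZeroUpperAtThree` (stmt-21393); `hcert` = on every non-CM globally minimal (t′)
rank-one `W` with `ρ̄_{E,3}` IRREDUCIBLE, ONE Kolyvagin NON-divisibility certificate at depth `ord₃ ∏_ℓ c_ℓ(E) + v₃(c(Dt)) + 1`
at every admissible Heegner datum (the class-wide form of the indivisibility half of the refined Kolyvagin conjecture at the
additive `3`, Manin-robust; RESEARCH-open, certifiable pair by pair); `hred` = the lower half on the (t′) rank-one rows with
`ρ̄_{E,3}` REDUCIBLE (rational `3`-isogeny; 2 705 of the 3 533 census classes; no Heegner-side structure theorem in print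
there — displayed residual). CONDITIONAL; credits nothing toward 23739. [cite: MatarNekovar2019, Thm. 0.7 (p. 456) and §0.11 (p. 457)]
[cite: WZhang2014, Thm. 1.1 and §3.8 (the refined Kolyvagin conjecture, p ∤ N)] [cite: GrossZagier1986, I.(6.3) and Thm. I.(7.3)] -/
theorem tprimeRankOneLowerAtThree_of_kolyvaginCertificates_of_reducibleRows (hF : ToricPublishedInputs)
    (hMNlow : MatarNekovar2019.thm07_pow_dvd_card_sha_primary_of_certificate_of_irreducible)
    (hU0 : Summit.BirchSwinnertonDyer.BirchSwinnertonDyer.Theses.TameQuarticSolvent.TprimeRankZeroUpperAtThree)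
    (hcert : ∀ (W : WeierstrassCurve ℚ) [W.IsElliptic] [W.IsGloballyMinimal], ¬ W.HasCM → Addv W 3 → SubTprime W 3 →
      W.HasIrreducibleModPGaloisRep 3 → W.analyticRank = 1 →
      ∀ (N : ℕ) [NeZero N] (K : Type) [Field K] [NumberField K] (Dt : ModularParametrizationData W N)
      (H : HeegnerDatum N (NumberField.discr K)) (ι : K →+* ℂ) (P : (W.baseChange K).toAffine.Point),
      W.conductorNorm ℤ = N → IsImaginaryQuadratic K → SatisfiesHeegnerHypothesis N K → Odd (NumberField.discr K) →
      NumberField.discr K < -4 → (W.quadraticTwist (NumberField.discr K : ℚ)).entireLFunction 1 ≠ 0 →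
      WeierstrassCurve.Affine.Point.map ι.toRatAlgHom P = heegnerPointComplex Dt H → ¬ IsOfFinAddOrder P →
      ∃ (n : ℕ) (d : KolyvaginHeegnerData Dt H.β ι n), Squarefree n ∧
        (∀ ℓ ∈ n.primeFactors, Zhang2014.IsKolyvaginPrime N W K 3 ℓ ∧
          padicValNat 3 W.tamagawaProduct + padicValNat 3 Dt.c.natAbs + 1 ≤ Zhang2014.kolyvaginIndex W 3 ℓ) ∧
        ¬ Koly.PDiv d 3 (padicValNat 3 W.tamagawaProduct + padicValNat 3 Dt.c.natAbs + 1))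
    (hred : ∀ (W : WeierstrassCurve ℚ) [W.IsElliptic] [W.IsGloballyMinimal], ¬ W.HasCM → Addv W 3 → SubTprime W 3 →
      ¬ W.HasIrreducibleModPGaloisRep 3 → W.analyticRank = 1 → MissingLowerBoundAt W 3) :
    Summit.BirchSwinnertonDyer.BirchSwinnertonDyer.Theses.TameQuarticManinParity.TprimeRankOneLowerAtThree := by
  intro W _ _ hCM hadd hT hr
  by_cases hirr : W.HasIrreducibleModPGaloisRep 3
  · exact tprime_missingLowerBoundAt_three_of_kolyvaginCertificates hF hMNlow hU0 W hCM hadd hT hirr hr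
      (hcert W hCM hadd hT hirr hr)
  · exact hred W hCM hadd hT hirr hr

/-! ### §4 The same lower half in the refined-Kolyvagin (`M_∞`) currency of the O5/O6 cell: tower-onto rows -/

/-- **The (t′) rank-one LOWER half at `3` in RKC currency (`3`-adic tower-onto rows).** For ONE globally minimal non-CM
`W`, additive of class (t′) at `3`, `r_an = 1`, with `ρ_{E,3^n}` onto for every `n ≥ 1` (`AdditiveThree.TowerSurjThree W`):
ToricPublishedInputs ∧ `AdditiveThree.OneClassLowerBoundShape` (Kolyvagin's structure theorem at `3`, LOWER form: McCallum 1991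
Thm. 5.4 as proved — ONE class that is not `3^{m+1}`-divisible produces `Ш`) ∧ TQS crux #4 (stmt-21393) ∧ [the MANIN-ROBUST
INDIVISIBILITY `¬ MinftyGe W K Dt H.β ι (ord₃ ∏_ℓ c_ℓ(E) + v₃(c(Dt)) + 1)` at every admissible Heegner datum of `W` at level
`N_E` — «`M_∞ ≤ ord₃(c·∏c_ℓ)`», the indivisibility half T1⁻ of the refined Kolyvagin conjecture at an additive `3`
(`AdditiveThree.RKC3Indivisibility` is its `3 ∤ c` case)] ⟹ `Typed.MissingLowerBoundAt W 3`. STEP L from the shape and the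
indivisibility is route SOED's width lemma `indexLowerBoundLeAt_of_oneClassLowerBound_of_not_minftyGe` (p592658); the rest is
§1/§2. This is the SAME conjecture currency as the wild rank-one road `wAllExclAddWildRankOneSurj_of_indivisibility`: the two
rank-one lower halves at an additive `3` — (t′) tame and wild — are one typed conjecture (T1⁻, Manin-robust) modulo print, the
Kato-side upper items at the twists, and the reducible / non-tower rows. CONDITIONAL; closes nothing.
[cite: McCallumLMS1991, Thm. 5.4 (p. 288), Thm. 5.8 (p. 290)] [cite: WZhang2014, Thm. 1.1, §3.8, Remark 18] -/
theorem tprime_missingLowerBoundAt_three_of_oneClassLowerBound_of_not_minftyGe (hF : ToricPublishedInputs)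
    (hSL : AdditiveThree.OneClassLowerBoundShape)
    (hU0 : Summit.BirchSwinnertonDyer.BirchSwinnertonDyer.Theses.TameQuarticSolvent.TprimeRankZeroUpperAtThree)
    (W : WeierstrassCurve ℚ) [W.IsElliptic] [W.IsGloballyMinimal] (hCM : ¬ W.HasCM) (hadd : Addv W 3)
    (hT : SubTprime W 3) (hρ : AdditiveThree.TowerSurjThree W) (hr : W.analyticRank = 1)
    (hInd : ∀ [NeZero (W.conductorNorm ℤ)] (K : Type) [Field K] [NumberField K]
      (Dt : ModularParametrizationData W (W.conductorNorm ℤ))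
      (H : HeegnerDatum (W.conductorNorm ℤ) (NumberField.discr K)) (ι : K →+* ℂ) (P : (W.baseChange K).toAffine.Point),
      IsImaginaryQuadratic K → SatisfiesHeegnerHypothesis (W.conductorNorm ℤ) K → Odd (NumberField.discr K) →
      NumberField.discr K < -4 → (W.quadraticTwist (NumberField.discr K : ℚ)).entireLFunction 1 ≠ 0 →
      WeierstrassCurve.Affine.Point.map ι.toRatAlgHom P = heegnerPointComplex Dt H → ¬ IsOfFinAddOrder P →
      ¬ AdditiveThree.MinftyGe W K Dt H.β ι (padicValNat 3 W.tamagawaProduct + padicValNat 3 Dt.c.natAbs + 1)) :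
    MissingLowerBoundAt W 3 := by
  haveI : Fact (Nat.Prime 3) := ⟨Nat.prime_three⟩
  refine missingLowerBoundAt_of_indexLower_of_twistUpperOdd_row 3 (by norm_num) hF W hadd hr ?_
    (fun N _ K _ _ Wd _ _ hN hK hHN hodd _ hWd hLd ↦
      missingUpperBoundAt_twist_of_tprimeRankZeroUpperAtThree hU0 W hCM hadd hT hN K hK hHN hodd Wd hWd hLd)
  intro N _ K _ _ Dt H ι P hN hK hHN hodd hd4 hLd hP hnt
  subst hN
  have h3 : NumberField.discr K ≠ -3 := by omega
  have h4 : NumberField.discr K ≠ -4 := by omega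
  exact Summit.BirchSwinnertonDyer.BirchSwinnertonDyer.Theorems.WildSplitEisensteinInclusionAtThreeIndivisibilityRoad.indexLowerBoundLeAt_of_oneClassLowerBound_of_not_minftyGe
    hSL W hρ K hK h3 h4 hHN Dt H ι P hP hnt (padicValNat 3 Dt.c.natAbs) (hInd K Dt H ι P hK hHN hodd hd4 hLd hP hnt)

/-- **TQMP crux #5 (stmt-23739) BY NAME in RKC currency**: ToricPublishedInputs ∧ `OneClassLowerBoundShape` ∧ 21393 ∧
[Manin-robust indivisibility T1⁻ on the non-CM (t′) rank-one `3`-adic tower-onto rows, at every admissible Heegner datum] ∧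
[the lower half on the non-CM (t′) rank-one rows whose `3`-adic tower is NOT onto (reducible, non-surjective, or
`9`-deficient image) — displayed residual]. CONDITIONAL; credits nothing toward 23739.
[cite: McCallumLMS1991, Thm. 5.4 (p. 288)] [cite: WZhang2014, Thm. 1.1 and §3.8] -/
theorem tprimeRankOneLowerAtThree_of_oneClassLowerBound_of_not_minftyGe_of_nonTowerRows (hF : ToricPublishedInputs)
    (hSL : AdditiveThree.OneClassLowerBoundShape)
    (hU0 : Summit.BirchSwinnertonDyer.BirchSwinnertonDyer.Theses.TameQuarticSolvent.TprimeRankZeroUpperAtThree)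
    (hInd : ∀ (W : WeierstrassCurve ℚ) [W.IsElliptic] [W.IsGloballyMinimal] [NeZero (W.conductorNorm ℤ)],
      ¬ W.HasCM → Addv W 3 → SubTprime W 3 → AdditiveThree.TowerSurjThree W → W.analyticRank = 1 →
      ∀ (K : Type) [Field K] [NumberField K] (Dt : ModularParametrizationData W (W.conductorNorm ℤ))
      (H : HeegnerDatum (W.conductorNorm ℤ) (NumberField.discr K)) (ι : K →+* ℂ) (P : (W.baseChange K).toAffine.Point),
      IsImaginaryQuadratic K → SatisfiesHeegnerHypothesis (W.conductorNorm ℤ) K → Odd (NumberField.discr K) →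
      NumberField.discr K < -4 → (W.quadraticTwist (NumberField.discr K : ℚ)).entireLFunction 1 ≠ 0 →
      WeierstrassCurve.Affine.Point.map ι.toRatAlgHom P = heegnerPointComplex Dt H → ¬ IsOfFinAddOrder P →
      ¬ AdditiveThree.MinftyGe W K Dt H.β ι (padicValNat 3 W.tamagawaProduct + padicValNat 3 Dt.c.natAbs + 1))
    (hnon : ∀ (W : WeierstrassCurve ℚ) [W.IsElliptic] [W.IsGloballyMinimal], ¬ W.HasCM → Addv W 3 → SubTprime W 3 →
      ¬ AdditiveThree.TowerSurjThree W → W.analyticRank = 1 → MissingLowerBoundAt W 3) :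
    Summit.BirchSwinnertonDyer.BirchSwinnertonDyer.Theses.TameQuarticManinParity.TprimeRankOneLowerAtThree := by
  intro W _ _ hCM hadd hT hr
  by_cases hρ : AdditiveThree.TowerSurjThree W
  · exact tprime_missingLowerBoundAt_three_of_oneClassLowerBound_of_not_minftyGe hF hSL hU0 W hCM hadd hT hρ hr
      (fun K _ _ Dt H ι P hK hHN hodd hd4 hLd hP hnt ↦ hInd W hCM hadd hT hρ hr K Dt H ι P hK hHN hodd hd4 hLd hP hnt)
  · exact hnon W hCM hadd hT hρ hr

end Summit.BirchSwinnertonDyer.BirchSwinnertonDyer.Theorems.TprimeRankOneLowerKolyvagin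

end
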